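import Summits.QuantumFields.YangMills.Theorems.FluctuationComparisonRegPrIntLS1aAlphaMemOfRows
import HarnessLib

/-!
# S1a · UV3-NODE §69.11 — THE (m2) DOOR WITH A WINDOW MAJORANT IN PLACE OF (41)'s `up`: for ANY version `ρ` and ANY `G ≥ low` with `ρ ≤ e^{−E+Rm}·G` on the window — the
# form in which the δ7-upper binder is dischargeable even if `up` itself is not continuous (sharp cutoffs); `R0`, `Z0`, `LFSum`, `ChiRange` are then NOT needed

Cell `ym3-torus` (YM ladder rung R3 = continuum `SU(2)` Yang–Mills on the three-torus — a RUNG: NOT d = 4, NOT infinite volume, NOT a mass gap, NOT Clay).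
Width seat «width 8» `ym3-torus-px8` (gen 23), FREE px helper on crux `stmt-QuantumFields-20520`, count-neutral, DEFINITION-FREE, default heartbeats; the generalisation recorded in
UV3-NODE §69.11 (2) «CAVEAT» of ✓p822164 `…S1aAlphaMemVersionOfRows.mem_version_of_alphaRows`: the (41)-side input is ANY function `G` with `low K k ≤ G` everywhere and
`ρ ≤ e^{−E_k+Rm_k}·G` on the `θBal(K−k)`-window; the witness's large-field part is `lf := e^{E_k}·e^{−E_k+Rm_k}·(G − low K k)`.  With `G := up K k` (and `low ≤ up` from R0 + Z0 +
`LFSum`, ✓`T3AlphaInputsACHistorySplit.low_le_up`) this IS ✓p822164; with a window-CONTINUOUS majorant `G` the canonical-version docking (✓p822781's `hupc`) asks continuity of `G`,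
not of `up` — which a construction with sharp characteristic functions can still supply.  Inputs that DROP OUT relative to ✓p822164: `hR0`, `hZ`, `LFSum`, `ChiRange`.

WHAT — ★★★ `mem_version_of_alphaRows_majorant` (run `K`, level `k ≤ K`): `BalabanUVClass.Mem (blockAvg ℰp) prm (fun W => e^{E_k}·ρ W)` with ✓p821956's explicit `prm`, from the typed
(α) schemas `IsLocal`, `GaugeInv26`, `TermSize`, `PintDecomp`, `AdmOnSmall`, `LocCover`, `EnlBounded`, `LocBlockVolume`, `MainTermIsAction`; the version's `ρ ≥ 0`, `Measurable ρ`,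
`GaugeInvariant ρ`; `h47ρ` ((47′) pointwise on the window); the MAJORANT data `G`, `hGlow : low ≤ G`, `h41G : ρ ≤ e^{−E+Rm}·G` on the window; the displayed rows `hχ1` (δ8), `hBU` (δ1),
`hDiam` (δ4), `hsub` (X ⊂ X̃); the displayed UNPRINTED δ2-b `hRegClass`; and the LF debt `hlfle`∕`hlarge` for THIS `lf` and `e^{E_k}·ρ`.

WHAT THIS FILE IS NOT: a choice of `G`; a discharge of any binder; nothing of Bałaban's asserted or proved; crux 20520, 19936, 19200, `YM3TorusSU2` NOT proved; no registered stub
closed; rung R3 = SU(2) YM₃ on T³ — NOT d = 4, NOT infinite volume, NOT a mass gap, NOT Clay.  Sorry-free, axioms standard.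

References: T. Bałaban, CMP **102** (1985) 255–275 [Balaban1985UV3] ((24)–(26) pp.262–263, (41)–(47) pp.266–267).
-/

set_option autoImplicit false

noncomputable section

namespace Summit.QuantumFields.YangMills.Theorems.FluctuationComparisonRegPrIntLS1aAlphaMemMajorantOfRows

open Finset MeasureTheory
open scoped BigOperators
open Literature.MathematicalPhysics.QuantumFieldTheory.Balaban1983to89
open T3ContinuumYM3Torus T3UnitScaleTilt T3UnitLawDensityEML T3RestrictedUnitDensity T3AlphaInputsAC T3AlphaInputsACSchemas BalabanUVClass
open T3AlphaInputsACTwoRunLevel (LocBlockVolume)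
open B10Eq42TorusConstraint (bondsIn mem_bondsIn_iff)
open B10Eq38TorusDomains (IsBlockUnion bdist)
open B5Eq118OneStroke (iterBlockOf)
open Summit.QuantumFields.YangMills.Theorems.FluctuationComparisonRegPrIntLS1aAlphaActivitySystem (sum_equivFin_symm_eq)
open Summit.QuantumFields.YangMills.Theorems.FluctuationComparisonRegPrIntLS1aAlphaLocalCover (coverShape_of_alpha)
open Summit.QuantumFields.YangMills.Theorems.FluctuationComparisonRegPrIntLS1aAlphaFootDiam (diamFoot_le)

variable {F : T3Family} {γ : ℝ}

/-! ## §1 The door with a window majorant -/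

open Classical in
/-- ★★★ **THE (m2) DOOR WITH A WINDOW MAJORANT** (run `K`, level `k ≤ K`): as ✓p822164 `mem_version_of_alphaRows`, with (41)'s `up K k` replaced by ANY `G ≥ low K k` such that
`ρ ≤ e^{−E_k+Rm_k}·G` on the `θBal(K−k)`-window; `lf := e^{E_k}·e^{−E_k+Rm_k}·(G − low K k)`.  No `R0`∕`Z0`∕`LFSum`∕`ChiRange` input. [cite: Balaban1985UV3, (41)-(47) pp.266-267 and (24)-(26) pp.262-263] -/
theorem mem_version_of_alphaRows_majorant (D : AlphaDataT3 F γ) {b₀ p₀ C κ₁ C' r CD δreg δL cLF c5 : ℝ} {M₁ : ℕ} {K k : ℕ} (hk : k ≤ K)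
    (ρ : GaugeField (F.P K) k (Matrix.specialUnitaryGroup (Fin 2) ℂ) → ℝ) (hρ0 : ∀ W, 0 ≤ ρ W) (hρm : Measurable ρ) (hρGI : GaugeField.GaugeInvariant ρ)
    -- typed (α) schemas
    (hloc : IsLocal D) (hgi : GaugeInv26 D) (hts : TermSize D b₀ p₀ C κ₁) (hdec : PintDecomp D) (hadm : AdmOnSmall D b₀ p₀)
    (hLC : LocCover D κ₁ C') (hEnl : EnlBounded D M₁ r) (hBV : LocBlockVolume D)
    (hM : MainTermIsAction D)
    (hr : 0 ≤ r) (hM1 : 1 ≤ M₁) (hMdvd : M₁ ∣ 2 * F.L ^ F.m) (hCD : 0 ≤ CD)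
    -- (47′)∕(41′) for THIS version, pointwise on the window (δ7)
    (h47ρ : ∀ W : GaugeField (F.P K) k (Matrix.specialUnitaryGroup (Fin 2) ℂ), PlaqSmall (θBal F.L γ b₀ p₀ (K - k)) W →
      Real.exp (-(D.Ecst K k) - D.Rm K k) * D.low K k W ≤ ρ W)
    -- the (41)-side MAJORANT: any `G ≥ low` with `ρ ≤ e^{−E+Rm}·G` on the window (`G := up K k` is ✓p822164)
    (G : GaugeField (F.P K) k (Matrix.specialUnitaryGroup (Fin 2) ℂ) → ℝ)
    (hGlow : ∀ W : GaugeField (F.P K) k (Matrix.specialUnitaryGroup (Fin 2) ℂ), D.low K k W ≤ G W)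
    (h41G : ∀ W : GaugeField (F.P K) k (Matrix.specialUnitaryGroup (Fin 2) ℂ), PlaqSmall (θBal F.L γ b₀ p₀ (K - k)) W →
      ρ W ≤ Real.exp (-(D.Ecst K k) + D.Rm K k) * G W)
    -- rows the socket lacks (UV3-NODE §69.2 ∕ §69.9), displayed
    (hχ1 : ∀ W : GaugeField (F.P K) k (Matrix.specialUnitaryGroup (Fin 2) ℂ), PlaqSmall (θBal F.L γ b₀ p₀ (K - k)) W → D.χ K k W = 1)
    (hBU : ∀ i, 1 ≤ i → i ≤ k → ∀ Y ∈ D.Loc K k (D.triv K k) i, IsBlockUnion (M₁ * F.L ^ i) Y)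
    (hDiam : ∀ i, 1 ≤ i → i ≤ k → ∀ Y ∈ D.Loc K k (D.triv K k) i, ∀ x ∈ Y, ∀ y ∈ Y, bdist (F.P K) M₁ i x y ≤ CD * D.treeLen K i Y)
    (hsub : ∀ K i (Y : Set (Site (F.P K) 0)), Y ⊆ D.enl K i Y)
    -- δ2-b: UNPRINTED (UV3-NODE l.426 G-K1a-1); removed by δ2-a (RULING №82)
    (hRegClass : ∀ W : GaugeField (F.P K) k (Matrix.specialUnitaryGroup (Fin 2) ℂ), PlaqSmall (θBal F.L γ b₀ p₀ (K - k)) W →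
      IsBackground (fun i => BlockAveraging.blockAvg (P := F.P K) (j := i) ℰp) {U | PlaqSmall δreg U} k W (D.Umin K k (D.triv K k) W))
    -- the large-field debt (δ9–δ10 + [B82] §3.C), in `Witness` shape, for this version
    (hlfle : ∀ W : GaugeField (F.P K) k (Matrix.specialUnitaryGroup (Fin 2) ℂ),
      Real.exp (D.Ecst K k) * (Real.exp (-(D.Ecst K k) + D.Rm K k) * (G W - D.low K k W)) ≤
        Real.exp (-cLF) * Real.exp (c5 * Fintype.card (Site (F.P K) k)))
    (hlarge : ∀ (W : GaugeField (F.P K) k (Matrix.specialUnitaryGroup (Fin 2) ℂ)) (S : Finset (Plaq (F.P K) k)),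
      (∀ p ∈ S, δL ≤ GaugeGroup.dist1 (GaugeField.plaqHol W p)) →
        Real.exp (D.Ecst K k) * ρ W ≤ Real.exp (-(cLF * S.card)) * Real.exp (c5 * Fintype.card (Site (F.P K) k))) :
    Mem (P := F.P K) (k := k) (fun i => BlockAveraging.blockAvg (P := F.P K) (j := i) ℰp)
      { δ := θBal F.L γ b₀ p₀ (K - k), δreg := δreg, δL := δL, β := (F.scheme ℰp γ).β K, κ := κ₁, M := 2 * r + 18 * M₁ + 3 + CD,
        Ccov := max C 0 * θBal F.L γ b₀ p₀ (K - k + 1) ^ 2 * (2 * max C' 0 * (7 + 2 * r + 18 * M₁) ^ 3), cE := 0, slack := D.Rm K k,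
        cLF := cLF, c5 := c5 }
      (fun W => Real.exp (D.Ecst K k) * ρ W) := by
  classical
  -- the tagged domain index and its numbering (as ✓`activitySystem_of_alpha`)
  set s : Finset (Σ _ : ℕ, Set (Site (F.P K) 0)) := (Finset.Icc 1 k).sigma (fun i => D.Loc K k (D.triv K k) i) with hs
  set tag : Fin s.card → (Σ _ : ℕ, Set (Site (F.P K) 0)) := fun X => ((s.equivFin.symm X : s) : Σ _ : ℕ, Set (Site (F.P K) 0)) with htag
  have htag_mem : ∀ X, tag X ∈ s := fun X => (s.equivFin.symm X).2
  have hlvl : ∀ X, 1 ≤ (tag X).1 ∧ (tag X).1 ≤ k ∧ (tag X).2 ∈ D.Loc K k (D.triv K k) (tag X).1 := fun X => by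
    have h := htag_mem X
    rw [hs, Finset.mem_sigma, Finset.mem_Icc] at h
    exact ⟨h.1.1, h.1.2, h.2⟩
  -- constants
  set wt : Fin s.card → ℝ := fun X => max C 0 * θBal F.L γ b₀ p₀ (K - k + 1) ^ 2 * (((F.L : ℝ) ^ (k - (tag X).1))⁻¹) ^ 4 with hwt
  have hwt0 : ∀ X, 0 ≤ wt X := fun X => by positivity
  -- the activity sum is `Pint` at the trivial history
  have hact : ∀ W : GaugeField (F.P K) k (Matrix.specialUnitaryGroup (Fin 2) ℂ),
      (∑ X : Fin s.card, D.Pterm K (tag X).1 (tag X).2 (D.Umin K k (D.triv K k) W)) = D.Pint K k (D.triv K k) W := fun W => by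
    rw [hdec K k (D.triv K k) W]
    have h1 := sum_equivFin_symm_eq s (fun x => D.Pterm K x.1 x.2 (D.Umin K k (D.triv K k) W))
    change ∑ X : Fin s.card, D.Pterm K (tag X).1 (tag X).2 (D.Umin K k (D.triv K k) W) = _
    rw [h1, hs, Finset.sum_sigma]
  -- the witness
  refine ⟨{
    bg := fun W => D.Umin K k (D.triv K k) W
    nDom := s.card
    supp := fun X => bondsIn 0 (D.enl K (tag X).1 (tag X).2)
    foot := fun X => Finset.univ.filter (fun y => ∃ z ∈ D.enl K (tag X).1 (tag X).2, iterBlockOf k z = y)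
    len := fun X => D.treeLen K (tag X).1 (tag X).2
    wt := wt
    act := fun X => D.Pterm K (tag X).1 (tag X).2
    cst := 0
    lf := fun W => Real.exp (D.Ecst K k) * (Real.exp (-(D.Ecst K k) + D.Rm K k) * (G W - D.low K k W))
    nonneg := fun W => mul_nonneg (Real.exp_nonneg _) (hρ0 W)
    measurable := hρm.const_mul _
    gaugeInvariant := fun u W => by
      show Real.exp (D.Ecst K k) * ρ (GaugeField.gaugeAct u W) = Real.exp (D.Ecst K k) * ρ W
      rw [hρGI u W]
    isBackground := hRegClass
    foot_nonempty := ?_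
    supp_foot := ?_
    len_nonneg := fun X => hLC.1 K (tag X).1 (tag X).2
    wt_nonneg := hwt0
    diam_foot := ?_
    act_local := fun X U U' hUU' => hloc K (tag X).1 (tag X).2 U U' fun b hb => hUU' b hb
    act_gaugeInvariant := fun X => hgi K (tag X).1 (tag X).2
    act_bound := ?_
    cover := ?_
    cst_abs_le := by simp
    lower := ?_
    upper := ?_
    lf_nonneg := fun W => mul_nonneg (Real.exp_nonneg _) (mul_nonneg (Real.exp_nonneg _) (sub_nonneg.mpr (hGlow W)))
    lf_le := hlfle
    large := hlarge }⟩
  · intro X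
    obtain ⟨z, hz⟩ := T3AlphaInputsACTwoRunLevel.LocBlockVolume.nonempty hBV (hlvl X).2.2
    exact ⟨iterBlockOf k z, Finset.mem_filter.mpr ⟨Finset.mem_univ _, z, hsub K _ _ hz, rfl⟩⟩
  · intro X b hb
    have h1 : b.src ∈ D.enl K (tag X).1 (tag X).2 := by
      have := (mem_bondsIn_iff.mp hb).1
      simpa using this
    exact Finset.mem_filter.mpr ⟨Finset.mem_univ _, b.src, h1, rfl⟩
  · intro X y hy y' hy'
    exact diamFoot_le D hEnl hr hM1 hCD hLC.1 hk (hlvl X).2.1 (hDiam (tag X).1 (hlvl X).1 (hlvl X).2.1) (hlvl X).2.2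
      (Finset.mem_filter.mp hy).2 (Finset.mem_filter.mp hy').2
  · intro X W hW
    have hmem := hlvl X
    have hsz := hts.2 K k (D.triv K k) W hk (hadm K k W hk hW) (tag X).1 hmem.1 hmem.2.1 (tag X).2 hmem.2.2
    refine hsz.trans ?_
    show C * Real.exp (-κ₁ * D.treeLen K (tag X).1 (tag X).2) * θBal F.L γ b₀ p₀ (K - k + 1) ^ 2 * (((F.L : ℝ) ^ (k - (tag X).1))⁻¹) ^ 4 ≤
      wt X * Real.exp (-(κ₁ * D.treeLen K (tag X).1 (tag X).2))
    rw [hwt]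
    have hexp : 0 ≤ Real.exp (-κ₁ * D.treeLen K (tag X).1 (tag X).2) := Real.exp_nonneg _
    have hθ2 : 0 ≤ θBal F.L γ b₀ p₀ (K - k + 1) ^ 2 := sq_nonneg _
    have hL4 : 0 ≤ (((F.L : ℝ) ^ (k - (tag X).1))⁻¹) ^ 4 := by positivity
    calc C * Real.exp (-κ₁ * D.treeLen K (tag X).1 (tag X).2) * θBal F.L γ b₀ p₀ (K - k + 1) ^ 2 * (((F.L : ℝ) ^ (k - (tag X).1))⁻¹) ^ 4
        ≤ max C 0 * Real.exp (-κ₁ * D.treeLen K (tag X).1 (tag X).2) * θBal F.L γ b₀ p₀ (K - k + 1) ^ 2 * (((F.L : ℝ) ^ (k - (tag X).1))⁻¹) ^ 4 := by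
          gcongr; exact le_max_left C 0
      _ = max C 0 * θBal F.L γ b₀ p₀ (K - k + 1) ^ 2 * (((F.L : ℝ) ^ (k - (tag X).1))⁻¹) ^ 4 * Real.exp (-(κ₁ * D.treeLen K (tag X).1 (tag X).2)) := by
          rw [neg_mul]; ring
  · intro y
    show ∑ X ∈ Finset.univ.filter (fun X => y ∈ Finset.univ.filter (fun y => ∃ z ∈ D.enl K (tag X).1 (tag X).2, iterBlockOf k z = y)),
        wt X * Real.exp (-(κ₁ * D.treeLen K (tag X).1 (tag X).2)) ≤
      max C 0 * θBal F.L γ b₀ p₀ (K - k + 1) ^ 2 * (2 * max C' 0 * (7 + 2 * r + 18 * M₁) ^ 3)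
    have hcnt := coverShape_of_alpha D hLC hEnl hr hM1 hMdvd hk hBU y
    set g : (Σ _ : ℕ, Set (Site (F.P K) 0)) → ℝ := fun x =>
      if ∃ z ∈ D.enl K x.1 x.2, iterBlockOf k z = y then (((F.L : ℝ) ^ (k - x.1))⁻¹) ^ 4 * Real.exp (-κ₁ * D.treeLen K x.1 x.2) else 0 with hg
    have hsum : ∑ X ∈ Finset.univ.filter (fun X => y ∈ Finset.univ.filter (fun y => ∃ z ∈ D.enl K (tag X).1 (tag X).2, iterBlockOf k z = y)),
          wt X * Real.exp (-(κ₁ * D.treeLen K (tag X).1 (tag X).2)) =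
        max C 0 * θBal F.L γ b₀ p₀ (K - k + 1) ^ 2 * ∑ X : Fin s.card, g (tag X) := by
      rw [Finset.mul_sum, Finset.sum_filter]
      refine Finset.sum_congr rfl fun X _ => ?_
      simp only [Finset.mem_filter, Finset.mem_univ, true_and, hg, hwt]
      split_ifs with h
      · rw [neg_mul]; ring
      · ring
    rw [hsum, sum_equivFin_symm_eq s g, hs, ← Finset.sum_filter]
    exact mul_le_mul_of_nonneg_left hcnt (by positivity)
  · -- lower: (47′) for `ρ` on the window, `χ = 1` there, main term = `β_K·A(Umin)`, times `e^{E_k}`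
    intro W hW
    show Real.exp (-((F.scheme ℰp γ).β K * wilsonAction4 (D.Umin K k (D.triv K k) W)) +
        (∑ X : Fin s.card, D.Pterm K (tag X).1 (tag X).2 (D.Umin K k (D.triv K k) W)) + 0 - D.Rm K k) ≤ Real.exp (D.Ecst K k) * ρ W
    rw [hact W]
    have h := h47ρ W hW
    have hlow : D.low K k W = Real.exp (-(D.mainT K k (D.triv K k) W) + D.Pint K k (D.triv K k) W) := by
      unfold AlphaDataT3.low; rw [hχ1 W hW, one_mul]
    rw [hlow, ← Real.exp_add, hM K k (D.triv K k) W] at h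
    have hE : 0 < Real.exp (D.Ecst K k) := Real.exp_pos _
    calc Real.exp (-((F.scheme ℰp γ).β K * wilsonAction4 (D.Umin K k (D.triv K k) W)) + D.Pint K k (D.triv K k) W + 0 - D.Rm K k)
        = Real.exp (D.Ecst K k) * Real.exp (-(D.Ecst K k) - D.Rm K k +
            (-((F.scheme ℰp γ).β K * wilsonAction4 (D.Umin K k (D.triv K k) W)) + D.Pint K k (D.triv K k) W)) := by
          rw [← Real.exp_add]; congr 1; ring
      _ ≤ Real.exp (D.Ecst K k) * ρ W := mul_le_mul_of_nonneg_left h hE.le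
  · -- upper: the majorant on the window, `χ = 1` there, times `e^{E_k}`
    intro W hW
    show Real.exp (D.Ecst K k) * ρ W ≤
      Real.exp (-((F.scheme ℰp γ).β K * wilsonAction4 (D.Umin K k (D.triv K k) W)) +
        (∑ X : Fin s.card, D.Pterm K (tag X).1 (tag X).2 (D.Umin K k (D.triv K k) W)) + 0 + D.Rm K k) +
        Real.exp (D.Ecst K k) * (Real.exp (-(D.Ecst K k) + D.Rm K k) * (G W - D.low K k W))
    rw [hact W]
    have h := h41G W hW
    have hlow : D.low K k W = Real.exp (-(D.mainT K k (D.triv K k) W) + D.Pint K k (D.triv K k) W) := by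
      unfold AlphaDataT3.low; rw [hχ1 W hW, one_mul]
    have hE : 0 < Real.exp (D.Ecst K k) := Real.exp_pos _
    have hup : ρ W ≤ Real.exp (-((F.scheme ℰp γ).β K * wilsonAction4 (D.Umin K k (D.triv K k) W)) + D.Pint K k (D.triv K k) W +
        (-D.Ecst K k) + D.Rm K k) + Real.exp (-(D.Ecst K k) + D.Rm K k) * (G W - D.low K k W) := by
      calc ρ W ≤ Real.exp (-(D.Ecst K k) + D.Rm K k) * G W := h
        _ = Real.exp (-(D.Ecst K k) + D.Rm K k) * D.low K k W + Real.exp (-(D.Ecst K k) + D.Rm K k) * (G W - D.low K k W) := by ring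
        _ = _ := by rw [hlow, ← Real.exp_add, hM K k (D.triv K k) W]; ring_nf
    calc Real.exp (D.Ecst K k) * ρ W
        ≤ Real.exp (D.Ecst K k) *
            (Real.exp (-((F.scheme ℰp γ).β K * wilsonAction4 (D.Umin K k (D.triv K k) W)) + D.Pint K k (D.triv K k) W + (-D.Ecst K k) + D.Rm K k) +
              Real.exp (-(D.Ecst K k) + D.Rm K k) * (G W - D.low K k W)) := mul_le_mul_of_nonneg_left hup hE.le
      _ = Real.exp (-((F.scheme ℰp γ).β K * wilsonAction4 (D.Umin K k (D.triv K k) W)) + D.Pint K k (D.triv K k) W + 0 + D.Rm K k) +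
            Real.exp (D.Ecst K k) * (Real.exp (-(D.Ecst K k) + D.Rm K k) * (G W - D.low K k W)) := by
          rw [mul_add, ← Real.exp_add]; congr 2; ring

end Summit.QuantumFields.YangMills.Theorems.FluctuationComparisonRegPrIntLS1aAlphaMemMajorantOfRows

end
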